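import Summits.BirchSwinnertonDyer.Rank1Residual.Additive.RamifiedSevenMuFreeMultiplier
import HarnessLib

/-!
# The diagonal gauge is admissible and makes the μ-clause of `HasMuFreeRealisedZetaFamilyBody` automatic — PORT 2/2
# of ideator g66's kernel (`Cruxes/EllipticUnitValueSevenOfGZK/MuFreeMultiplierSeven_g66.lean` 66d29e3b022a13de, §5–§6 =
# l.360–542, = §0.5–§0.6 of g68 `RealisationAssemblySeven_g68.lean` d2c3fb8381c0379f) to a BUILT home

Crux `stmt-BirchSwinnertonDyer-19945` (K7r), the (E2)-PORT (vote V-E2 D962, ruling D973 (c); seat `bsd-cm-prr-ty1` g32).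
Statements and proofs VERBATIM from g66 (namespace `Summit.BirchSwinnertonDyer.Rank1Residual.Additive.MuFreeMultiplier`):

* §5 the symbol side: a `p`-primitive minus symbol exists (`exists_ratMinusSymbol_not_dvd`), the diagonal cusp factor
  (`ratMinusSymbol_mul_div_of_modEq_one`, `ratCuspFactor_diag`), and ★ `exists_diagonalGauge` — the gauge
  `(c, d₁, a, A, d′) = (1 + 6pA, 1 + 6pNA, a, A, 1)` with its four Manin coordinates all equal to one `n`, `p ∤ n`;
* §6 ★★ `muFree_conjunct_of_diagonalGauge` — the μ-free conjunct `¬ (p : Λ) ∣ katoMultiplier …` of the body in that gauge —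
  and `dvd_of_dvd_natCast_mul`.

Theorems only; no `def`, no instance, no notation, no `sorry`.  HONEST LABEL: kernel; nothing here proves (E2), the crux, or any
summit statement; BSD is claimed for no curve.

[cite: Kato2004Asterisque, §13.9 (p. 229), Lemma 13.10 (1) (p. 230), Thm. 6.6 (1) (pp. 162–163)] [cite: Manin1972, Thm. 1.6 and Cor. 3.6]
-/

set_option autoImplicit false

noncomputable section

open scoped Classical MatrixGroups ModularForm
open CongruenceSubgroup PowerSeries Field
open Literature.NumberTheory.EllipticCurves Literature.NumberTheory.EllipticCurves.Kato2004
  Literature.NumberTheory.EllipticCurves.IwasawaCharacter Literature.NumberTheory.GaloisRepresentations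
open Summit.BirchSwinnertonDyer.Rank1Residual.X11b.SigmaEulerMu

namespace Summit.BirchSwinnertonDyer.Rank1Residual.Additive.MuFreeMultiplier

variable {p : ℕ} [hp : Fact p.Prime]

/-! ## §5 The symbol side: a `p`-primitive minus symbol exists, and the diagonal gauge is admissible -/

section Symbols

variable {N : ℕ} (f : CuspForm (Gamma0 N) 2)

/-- **Some minus symbol is `p`-PRIMITIVE in the Manin lattice.**  If the rational minus symbols `[r]⁻_f` generate `ℤ·q⁻`
(`0 < q⁻`; the body's clause `AddSubgroup.closure (Set.range (ratMinusSymbol f)) = AddSubgroup.zmultiples qm`), then some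
`[a/A]⁻_f = n·q⁻` with `p ∤ n` (else every symbol lies in `ℤ·pq⁻ ⊊ ℤ·q⁻`). [cite: Manin1972, Thm. 1.6 and Cor. 3.6]
[cite: MazurTateTeitelbaum1986Invent, §I.8] -/
theorem exists_ratMinusSymbol_not_dvd {qm : ℚ} (hqm : 0 < qm)
    (hspan : AddSubgroup.closure (Set.range (ratMinusSymbol f)) = AddSubgroup.zmultiples qm) :
    ∃ (a : ℤ) (A : ℕ) (n : ℤ), 0 < A ∧ ratMinusSymbol f ((a : ℚ) / A) = n * qm ∧ ¬ (p : ℤ) ∣ n := by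
  by_contra H
  push Not at H
  -- every symbol lies in `ℤ · (p qm)`
  have hsub : Set.range (ratMinusSymbol f) ⊆ (AddSubgroup.zmultiples ((p : ℚ) * qm) : Set ℚ) := by
    rintro _ ⟨r, rfl⟩
    have hmem : ratMinusSymbol f r ∈ AddSubgroup.zmultiples qm := by
      rw [← hspan]; exact AddSubgroup.subset_closure ⟨r, rfl⟩
    obtain ⟨k, hk⟩ := AddSubgroup.mem_zmultiples_iff.mp hmem
    have hr : ratMinusSymbol f ((r.num : ℚ) / r.den) = k * qm := by
      rw [Rat.num_div_den r, ← hk, zsmul_eq_mul]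
    obtain ⟨k', hk'⟩ := H r.num r.den k r.den_pos hr
    refine AddSubgroup.mem_zmultiples_iff.mpr ⟨k', ?_⟩
    rw [← hk, hk', zsmul_eq_mul, zsmul_eq_mul]; push_cast; ring
  have hle : AddSubgroup.zmultiples qm ≤ AddSubgroup.zmultiples ((p : ℚ) * qm) := by
    rw [← hspan]; exact (AddSubgroup.closure_le _).mpr hsub
  have hqmem : qm ∈ AddSubgroup.zmultiples ((p : ℚ) * qm) := hle (AddSubgroup.mem_zmultiples qm)
  obtain ⟨k, hk⟩ := AddSubgroup.mem_zmultiples_iff.mp hqmem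
  rw [zsmul_eq_mul] at hk
  -- `k p qm = qm` with `qm ≠ 0`: `k p = 1` in `ℤ`, impossible for a prime `p`
  have hkp : (k : ℚ) * p = 1 := by
    have h := hk
    rw [← mul_assoc] at h
    exact mul_right_cancel₀ hqm.ne' (by rw [h, one_mul])
  have hkp' : k * (p : ℤ) = 1 := by exact_mod_cast hkp
  have hdvd : (p : ℤ) ∣ 1 := ⟨k, by rw [mul_comm, hkp']⟩
  exact hp.out.ne_one (Nat.dvd_one.mp (by exact_mod_cast hdvd))

/-- In the gauge `c ≡ 1 (mod A)`: `[a c/A]⁻ = [a/A]⁻` (periodicity `ratMinusSymbol_add_intCast`).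
[cite: MazurTateTeitelbaum1986Invent, §I.4 (4.2)] -/
theorem ratMinusSymbol_mul_div_of_modEq_one [NeZero N] {A : ℕ} (hA : 0 < A) {c : ℤ} (hc : (A : ℤ) ∣ c - 1) (a : ℤ) :
    ratMinusSymbol f ((a * c : ℚ) / A) = ratMinusSymbol f ((a : ℚ) / A) := by
  obtain ⟨k, hk⟩ := hc
  have hA' : (A : ℚ) ≠ 0 := by exact_mod_cast hA.ne'
  have hc' : (c : ℚ) = 1 + (A : ℚ) * k := by
    have : (c : ℤ) = 1 + (A : ℤ) * k := by omega
    exact_mod_cast this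
  have : ((a * c : ℚ) / A) = (a : ℚ) / A + ((a * k : ℤ) : ℚ) := by
    rw [hc', div_add' _ _ _ hA']
    push_cast
    congr 1
    ring
  rw [this, ratMinusSymbol_add_intCast]

/-- In the gauge `c ≡ 1 (mod A)`, `d′ = 1`: the rational four-cusp factor is `[a/A]⁻ · c d (c − 1)(d − 1)`.
[cite: Kato2004Asterisque, Thm. 6.6 (1) (p. 163), Lemma 13.10 (1) (p. 230)] -/
theorem ratCuspFactor_diag [NeZero N] {A : ℕ} (hA : 0 < A) {c : ℤ} (hc : (A : ℤ) ∣ c - 1) (d a : ℤ) :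
    ratCuspFactor f true c d a A 1 =
      ratMinusSymbol f ((a : ℚ) / A) * ((c : ℚ) * d * (c - 1) * (d - 1)) := by
  have h2 := ratMinusSymbol_mul_div_of_modEq_one f hA hc a
  have h3 : ratMinusSymbol f ((a * (1 : ℤ) : ℚ) / A) = ratMinusSymbol f ((a : ℚ) / A) := by
    rw [Int.cast_one, mul_one]
  have h4 : ratMinusSymbol f ((a * c * (1 : ℤ) : ℚ) / A) = ratMinusSymbol f ((a : ℚ) / A) := by
    rw [Int.cast_one, mul_one]; exact h2
  simp only [ratCuspFactor, ↓reduceIte]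
  rw [h2, h3, h4]
  ring

/-- **ADMISSIBLE DIAGONAL-GAUGE PARAMETERS.**  For a prime `p`, a level `N ≠ 0`, a form `f` whose minus symbols generate
`ℤ·q⁻` (`0 < q⁻`): the parameters `(c, d₁, a, A, d′) = (1 + 6pA, 1 + 6pNA, a, A, 1)` — with `[a/A]⁻ = n q⁻`, `p ∤ n` from
`exists_ratMinusSymbol_not_dvd` — satisfy EVERY guard of clause (A3) of `HasMuFreeRealisedZetaFamilyBody` (`0 < A`,
`gcd(c, 6pA) = 1`, `gcd(d₁, 6pN) = 1`, `d₁ d′ ≡ 1 (mod A)`, `R⁻ = ratCuspFactor f true c d₁ a A d′ ≠ 0`), the four symbol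
equations of clause (A5′) at ONE coordinate `n₁ = n₂ = n₃ = n₄ = n`, the hypotheses of §3–§4 (`p ∤ n`, `p ∤ c`, `p ∤ d₁`,
`c, d₁ ≠ ±1`), and the (C5) guard of `ZetaBody` at every `p`-power level (`gcd(c d₁, p^k A) = 1`; tame levels are prime to
`c d₁` by `badPlaces`). [cite: Kato2004Asterisque, §13.9 (p. 229), Lemma 13.10 (1) (p. 230), §13.12 (p. 231)]
[cite: MazurTateTeitelbaum1986Invent, §I.4 (4.2), §I.8] -/
theorem exists_diagonalGauge [NeZero N] {qm : ℚ} (hqm : 0 < qm)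
    (hspan : AddSubgroup.closure (Set.range (ratMinusSymbol f)) = AddSubgroup.zmultiples qm) :
    ∃ (c d₁ a : ℤ) (A : ℕ) (d' : ℤ) (n : ℤ),
      0 < A ∧ Int.gcd c (6 * p * A) = 1 ∧ Int.gcd d₁ (6 * p * N) = 1 ∧ (d₁ : ℤ) * d' ≡ 1 [ZMOD (A : ℤ)] ∧
      ratCuspFactor f true c d₁ a A d' ≠ 0 ∧
      ratMinusSymbol f ((a : ℚ) / A) = n * qm ∧ ratMinusSymbol f ((a * c : ℚ) / A) = n * qm ∧
      ratMinusSymbol f ((a * d' : ℚ) / A) = n * qm ∧ ratMinusSymbol f ((a * c * d' : ℚ) / A) = n * qm ∧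
      ¬ (p : ℤ) ∣ n ∧ ¬ (p : ℤ) ∣ c ∧ ¬ (p : ℤ) ∣ d₁ ∧ c ≠ 1 ∧ c ≠ -1 ∧ d₁ ≠ 1 ∧ d₁ ≠ -1 ∧
      (∀ k : ℕ, Int.gcd (c * d₁) (p ^ k * A) = 1) := by
  obtain ⟨a, A, n, hA, hn, hpn⟩ := exists_ratMinusSymbol_not_dvd (p := p) f hqm hspan
  have hN : 0 < N := Nat.pos_of_ne_zero (NeZero.ne N)
  have hp1 : 1 < p := hp.out.one_lt
  set c : ℤ := 1 + 6 * p * A with hcdef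
  set d₁ : ℤ := 1 + 6 * p * N * A with hddef
  have hpos : (0 : ℤ) < 6 * p * A := by positivity
  have hposd : (0 : ℤ) < 6 * p * N * A := by positivity
  have hcA : (A : ℤ) ∣ c - 1 := ⟨6 * p, by rw [hcdef]; ring⟩
  have hpc : ¬ (p : ℤ) ∣ c := by
    rw [hcdef, dvd_add_left (⟨6 * A, by ring⟩ : (p : ℤ) ∣ 6 * p * A)]
    intro h
    exact hp.out.ne_one (Nat.dvd_one.mp (by exact_mod_cast h))
  have hpd : ¬ (p : ℤ) ∣ d₁ := by
    rw [hddef, dvd_add_left (⟨6 * N * A, by ring⟩ : (p : ℤ) ∣ 6 * p * N * A)]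
    intro h
    exact hp.out.ne_one (Nat.dvd_one.mp (by exact_mod_cast h))
  have hn0 : n ≠ 0 := by rintro rfl; exact hpn (dvd_zero _)
  have h₁ : ratMinusSymbol f ((a : ℚ) / A) = n * qm := hn
  have h₂ : ratMinusSymbol f ((a * c : ℚ) / A) = n * qm := by
    rw [ratMinusSymbol_mul_div_of_modEq_one f hA hcA a, h₁]
  -- the (C5) guard of `ZetaBody` at every `p`-power level: `gcd(c d₁, p^k A) = 1`
  have hC5 : ∀ k : ℕ, Int.gcd (c * d₁) (p ^ k * A) = 1 := by
    intro k
    have hcp : IsCoprime c (p : ℤ) := ⟨1, -(6 * A), by rw [hcdef]; ring⟩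
    have hcA' : IsCoprime c (A : ℤ) := ⟨1, -(6 * p), by rw [hcdef]; ring⟩
    have hdp : IsCoprime d₁ (p : ℤ) := ⟨1, -(6 * N * A), by rw [hddef]; ring⟩
    have hdA : IsCoprime d₁ (A : ℤ) := ⟨1, -(6 * p * N), by rw [hddef]; ring⟩
    exact Int.isCoprime_iff_gcd_eq_one.mp
      (IsCoprime.mul_left (hcp.pow_right.mul_right hcA') (hdp.pow_right.mul_right hdA))
  refine ⟨c, d₁, a, A, 1, n, hA, ?_, ?_, ?_, ?_, h₁, h₂, ?_, ?_, hpn, hpc, hpd, ?_, ?_, ?_, ?_, hC5⟩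
  · -- `gcd(1 + 6pA, 6pA) = 1`
    exact Int.isCoprime_iff_gcd_eq_one.mp ⟨1, -1, by rw [hcdef]; ring⟩
  · -- `gcd(1 + 6pNA, 6pN) = 1`
    exact Int.isCoprime_iff_gcd_eq_one.mp ⟨1, -(A : ℤ), by rw [hddef]; ring⟩
  · -- `d₁ · 1 ≡ 1 (mod A)`
    exact Int.modEq_iff_dvd.mpr ⟨-(6 * p * N), by rw [hddef]; ring⟩
  · -- `R⁻ ≠ 0`
    rw [ratCuspFactor_diag f hA hcA d₁ a, h₁]
    have hc0 : (c : ℚ) ≠ 0 := by exact_mod_cast (show c ≠ 0 by omega)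
    have hd0 : (d₁ : ℚ) ≠ 0 := by exact_mod_cast (show d₁ ≠ 0 by omega)
    have hc1 : (c : ℚ) - 1 ≠ 0 := by
      have : ((c - 1 : ℤ) : ℚ) ≠ 0 := by exact_mod_cast (show c - 1 ≠ 0 by omega)
      push_cast at this; exact this
    have hd1 : (d₁ : ℚ) - 1 ≠ 0 := by
      have : ((d₁ - 1 : ℤ) : ℚ) ≠ 0 := by exact_mod_cast (show d₁ - 1 ≠ 0 by omega)
      push_cast at this; exact this
    have hnq : (n : ℚ) * qm ≠ 0 := mul_ne_zero (by exact_mod_cast hn0) hqm.ne'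
    exact mul_ne_zero hnq (mul_ne_zero (mul_ne_zero (mul_ne_zero hc0 hd0) hc1) hd1)
  · -- `[a d′/A]⁻` with `d′ = 1`
    rw [Int.cast_one, mul_one, h₁]
  · -- `[a c d′/A]⁻` with `d′ = 1`
    rw [Int.cast_one, mul_one, h₂]
  · omega
  · omega
  · omega
  · omega

end Symbols

/-! ## §6 The μ-free conjunct of the body in the diagonal gauge -/

section Conjunct

/-- **The μ-FREE CONJUNCT of `HasMuFreeRealisedZetaFamilyBody` in the diagonal gauge, VERBATIM shape** (`n₁ n₁ n₁ n₁`, `E =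
A.primeFactors.erase p`, `Ψ_b = Psi p ℤ_p K σ_b`, the Dirichlet data `fun ℓ => W.LFunction ℓ`, `fun ℓ => if ℓ ∣ N then 0 else 1`
being two instances of the arbitrary `aℓ εℓ`): for the cyclotomic `K` and parameters as in `exists_diagonalGauge`.  So the (E2)
prover who realises the family (clauses (A0)–(A4), the period clause and `0 ≤ e`) at these parameters gets the μ-free clause for
free. [cite: Kato2004Asterisque, §13.12 (p. 231), §13.14 (p. 234)] -/
theorem muFree_conjunct_of_diagonalGauge (K : ZpExtension ℚ p) (hK : K.IsCyclotomic)
    {c d₁ n : ℤ} (hc : ¬ (p : ℤ) ∣ c) (hd : ¬ (p : ℤ) ∣ d₁) (hc1 : c ≠ 1) (hc1' : c ≠ -1) (hd1 : d₁ ≠ 1) (hd1' : d₁ ≠ -1)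
    (hn : ¬ (p : ℤ) ∣ n) {σc σd : absoluteGaloisGroup ℚ} {σℓ : ℕ → absoluteGaloisGroup ℚ}
    (hσc : ((GaloisRep.cyclotomicCharacter ℚ p σc : ℤ_[p]ˣ) : ℤ_[p]) = c)
    (hσd : ((GaloisRep.cyclotomicCharacter ℚ p σd : ℤ_[p]ˣ) : ℤ_[p]) = d₁) {A : ℕ}
    (hσℓ : ∀ ℓ ∈ A.primeFactors.erase p, ((GaloisRep.cyclotomicCharacter ℚ p (σℓ ℓ) : ℤ_[p]ˣ) : ℤ_[p]) = ℓ)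
    (aℓ εℓ : ℕ → ℤ) :
    ¬ ((p : IwasawaAlgebra p) ∣
      katoMultiplier p c d₁ n n n n
        ((IwasawaCharacter.Psi p ℤ_[p] K σc : (PowerSeries ℤ_[p])ˣ) : IwasawaAlgebra p)
        ((IwasawaCharacter.Psi p ℤ_[p] K σd : (PowerSeries ℤ_[p])ˣ) : IwasawaAlgebra p)
        (A.primeFactors.erase p) aℓ εℓ
        (fun ℓ => ((IwasawaCharacter.Psi p ℤ_[p] K (σℓ ℓ) : (PowerSeries ℤ_[p])ˣ) : IwasawaAlgebra p))) :=
  not_natCast_dvd_katoMultiplier_psi_of_isCyclotomic K hK hc hd hc1 hc1' hd1 hd1' (fun h => hn h.1) hσc hσd hσℓ aℓ εℓ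

/-- **μ-free ⟺ `Λ/M̃Λ` is `p`-torsion-free** (the printed form of §13.12's requirement on `μ`): in `Λ = ℤ_p⟦T⟧`, `p` prime,
`p ∤ M` implies `M ∣ p·x → M ∣ x`. [cite: Kato2004Asterisque, §13.12 (p. 231, «Λ/μΛ is p-torsion free»)] [cite: Washington1997, §13.1] -/
theorem dvd_of_dvd_natCast_mul {M x : IwasawaAlgebra p} (hM : ¬ (p : IwasawaAlgebra p) ∣ M)
    (h : M ∣ (p : IwasawaAlgebra p) * x) : M ∣ x := by
  have hprime := prime_natCast_iwasawaAlgebra p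
  obtain ⟨y, hy⟩ := h
  -- `p ∣ M y` and `p ∤ M`, so `p ∣ y`
  have hpy : (p : IwasawaAlgebra p) ∣ y := by
    have : (p : IwasawaAlgebra p) ∣ M * y := ⟨x, by rw [← hy]⟩
    exact (hprime.dvd_or_dvd this).resolve_left hM
  obtain ⟨z, rfl⟩ := hpy
  refine ⟨z, ?_⟩
  have hp0 : (p : IwasawaAlgebra p) ≠ 0 := hprime.ne_zero
  apply mul_left_cancel₀ hp0
  rw [hy]; ring

end Conjunct

end Summit.BirchSwinnertonDyer.Rank1Residual.Additive.MuFreeMultiplier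

end
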